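import Summits.RiemannHypothesis.RiemannHypothesis.Theorems.RuelleBandCofiniteCriticalLineBoundedIndexIff
import Summits.RiemannHypothesis.RiemannHypothesis.Theorems.RuelleBandCofiniteCriticalLineBoundedIndexUnconditional
import Summits.RiemannHypothesis.RiemannHypothesis.Theorems.RuelleBandCofiniteCriticalLineStubWindowIndexFinite
import Summits.RiemannHypothesis.RiemannHypothesis.Theorems.RuelleBandCofiniteCriticalLineStubZeroLevelWindow
import Summits.RiemannHypothesis.RiemannHypothesis.Theorems.RuelleBandCofiniteCriticalLineStubZeroLevelNullVector
import Summits.RiemannHypothesis.RiemannHypothesis.Theorems.RuelleBandCofiniteCriticalLineStubCalibrationENDOfCofinite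
import HarnessLib

set_option linter.dupNamespace false

/-!
# END ⟺ `CofiniteCriticalLine` ⟺ BoundedWeilIndex — the bet of line `cofinite-weil-index-staircase`
is EXACTLY rung #5

Crux `Summit.RiemannHypothesis.RiemannHypothesis.Theses.RuelleBand.CofiniteCriticalLine` (item
stmt-RiemannHypothesis-2064), line `cofinite-weil-index-staircase`, lead c2 (2026-08-16).

END is the line's bet `stub_eventuallyNondegenerate` verbatim: for all large windows `a` the closed
Weil form on `[-a, a]` has no non-zero null vector in its form domain (no `u ∈ L²`, `u ≠ 0` a.e., that is
an `L²`- and form-Cauchy limit of window test functions `gₙ` with `W(gₙ ⋆ h̃) → 0` for every window test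
`h`).  This file assembles, in ONE kernel-checked place, the two directions:

* END ⟹ BoundedWeilIndex ⟹ crux (`boundedWeilIndex_of_END`, `cofiniteCriticalLine_of_END`): the
  line's composition — per-window finiteness of the index (`stub_windowIndexFinite`, p78224), the
  crossing lemma (`stub_zeroLevelWindow` p95831 ∘ `stub_zeroLevelNullVector` p95592) fed with CONTINUITY
  OF THE EIGENVALUE BRANCHES (taken as the hypothesis `hbc`; it is PROVED in the tree as
  `stub_branchesContinuous`, p84125, in a module that cannot be co-imported here because of the duplicate
  declaration `Literature.NumberTheory.LFunctions.WeilWindowSimpleEven`, audit:p43005), then Kreĭn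
  definitization + the cofinite Weil criterion (`cofiniteCriticalLine_of_boundedWeilIndex`, p107208);
* crux ⟹ END (`stub_calibration_END_of_cofinite_unconditional`, this lead), UNCONDITIONAL (the distinct
  zero count comes from Selberg's theorem, proved in the tree).

Hence `END_iff_cofiniteCriticalLine` and `END_iff_boundedWeilIndex`: modulo branch continuity alone
(a tree theorem, p84125) the bet of the line is rung #5 itself — the line is an exact operator-side
REFORMULATION of the crux, with no stub weaker than the crux.
-/

noncomputable section

open Complex MeasureTheory Filter Set
open scoped BigOperators Topology ComplexConjugate

namespace Summit.RiemannHypothesis.RiemannHypothesis.Theorems.RuelleBandCofiniteCriticalLine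

open Literature.NumberTheory.LFunctions

/-- Restriction: an index bound on a window passes to every smaller window. [folklore] -/
theorem endIff_windowIndexLE_anti {a b : ℝ} {N : ℕ} (hab : a ≤ b)
    (h : ∀ g : Fin (N + 1) → ℝ → ℂ, (∀ i, IsWeilTest (g i)) →
        (∀ i, tsupport (g i) ⊆ Set.Icc (-b) b) →
        ∃ c : Fin (N + 1) → ℂ, c ≠ 0 ∧ 0 ≤ (weilQuadratic (fun t => ∑ i, c i * g i t)).re) :
    ∀ g : Fin (N + 1) → ℝ → ℂ, (∀ i, IsWeilTest (g i)) →
      (∀ i, tsupport (g i) ⊆ Set.Icc (-a) a) →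
      ∃ c : Fin (N + 1) → ℂ, c ≠ 0 ∧ 0 ≤ (weilQuadratic (fun t => ∑ i, c i * g i t)).re :=
  fun g hg hsupp => h g hg fun i => (hsupp i).trans (Set.Icc_subset_Icc (neg_le_neg hab) hab)

/-- **END ⟹ BoundedWeilIndex, given continuity of the eigenvalue branches.**  `a₁ := max a₀ 1 > 0`
(`a₀` from END); `stub_windowIndexFinite` bounds the index on the window `a₁` by some `N`; smaller windows
inherit the bound by restriction; a larger window violating it would, by the crossing lemma
(`stub_zeroLevelWindow` then `stub_zeroLevelNullVector`, fed with branch continuity `hbc`), carry a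
non-zero null vector on some window in `[a₁, a] ⊆ [a₀, ∞)`, which END forbids. [folklore] -/
theorem boundedWeilIndex_of_END
    (hbc : ∀ k : ℕ, ContinuousOn (fun a : ℝ =>
      sInf {x : ℝ | ∃ g : Fin (k + 1) → ℝ → ℂ,
        (∀ i, IsWeilTest (g i) ∧ tsupport (g i) ⊆ Set.Icc (-a) a) ∧ LinearIndependent ℂ g ∧
        x = sSup {y : ℝ | ∃ c : Fin (k + 1) → ℂ,
          ∫ t, ‖∑ i, c i * g i t‖ ^ 2 = (1 : ℝ) ∧
          y = (weilQuadratic (fun t => ∑ i, c i * g i t)).re}}) (Set.Ioi 0))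
    (hEND : ∃ a₀ : ℝ, ∀ a : ℝ, a₀ ≤ a →
      ¬ ∃ (u : ℝ → ℂ) (g : ℕ → ℝ → ℂ), MemLp u 2 volume ∧ ¬ (u =ᵐ[volume] 0) ∧
          (∀ n, IsWeilTest (g n) ∧ tsupport (g n) ⊆ Set.Icc (-a) a) ∧
          Tendsto (fun n => ∫ t, ‖g n t - u t‖ ^ 2) atTop (𝓝 0) ∧
          Tendsto (fun q : ℕ × ℕ => (weilQuadratic (g q.1 - g q.2)).re) atTop (𝓝 0) ∧
          ∀ h : ℝ → ℂ, IsWeilTest h → tsupport h ⊆ Set.Icc (-a) a →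
            Tendsto (fun n => weilFunctional (weilConv (g n) (weilReflect h))) atTop (𝓝 0)) :
    ∃ N : ℕ, ∀ a : ℝ, ∀ g : Fin (N + 1) → ℝ → ℂ, (∀ i, IsWeilTest (g i)) →
        (∀ i, tsupport (g i) ⊆ Set.Icc (-a) a) →
        ∃ c : Fin (N + 1) → ℂ, c ≠ 0 ∧ 0 ≤ (weilQuadratic (fun t => ∑ i, c i * g i t)).re := by
  obtain ⟨a₀, ha₀⟩ := hEND
  obtain ⟨N, hN⟩ := stub_windowIndexFinite (max a₀ 1)
  refine ⟨N, fun a => ?_⟩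
  by_cases ha : a ≤ max a₀ 1
  · exact endIff_windowIndexLE_anti ha hN
  · intro g hg hsupp
    by_contra hneg
    have hfail : ¬ (∀ g : Fin (N + 1) → ℝ → ℂ, (∀ i, IsWeilTest (g i)) →
          (∀ i, tsupport (g i) ⊆ Set.Icc (-a) a) →
          ∃ c : Fin (N + 1) → ℂ, c ≠ 0 ∧ 0 ≤ (weilQuadratic (fun t => ∑ i, c i * g i t)).re) :=
      fun hall => hneg (hall g hg hsupp)
    have h1 : (0 : ℝ) < max a₀ 1 := lt_of_lt_of_le one_pos (le_max_right _ _)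
    obtain ⟨b, hb, hlev⟩ := stub_zeroLevelWindow hbc N (max a₀ 1) a h1 (not_le.mp ha).le hN hfail
    exact ha₀ b ((le_max_left _ _).trans hb.1)
      (stub_zeroLevelNullVector N b (lt_of_lt_of_le h1 hb.1) hlev)

/-- **END ⟹ `CofiniteCriticalLine`, given continuity of the eigenvalue branches** (the composition of line
`cofinite-weil-index-staircase`: `boundedWeilIndex_of_END`, then the unconditional rung
`cofiniteCriticalLine_of_boundedWeilIndex`). [folklore] -/
theorem cofiniteCriticalLine_of_END
    (hbc : ∀ k : ℕ, ContinuousOn (fun a : ℝ =>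
      sInf {x : ℝ | ∃ g : Fin (k + 1) → ℝ → ℂ,
        (∀ i, IsWeilTest (g i) ∧ tsupport (g i) ⊆ Set.Icc (-a) a) ∧ LinearIndependent ℂ g ∧
        x = sSup {y : ℝ | ∃ c : Fin (k + 1) → ℂ,
          ∫ t, ‖∑ i, c i * g i t‖ ^ 2 = (1 : ℝ) ∧
          y = (weilQuadratic (fun t => ∑ i, c i * g i t)).re}}) (Set.Ioi 0))
    (hEND : ∃ a₀ : ℝ, ∀ a : ℝ, a₀ ≤ a →
      ¬ ∃ (u : ℝ → ℂ) (g : ℕ → ℝ → ℂ), MemLp u 2 volume ∧ ¬ (u =ᵐ[volume] 0) ∧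
          (∀ n, IsWeilTest (g n) ∧ tsupport (g n) ⊆ Set.Icc (-a) a) ∧
          Tendsto (fun n => ∫ t, ‖g n t - u t‖ ^ 2) atTop (𝓝 0) ∧
          Tendsto (fun q : ℕ × ℕ => (weilQuadratic (g q.1 - g q.2)).re) atTop (𝓝 0) ∧
          ∀ h : ℝ → ℂ, IsWeilTest h → tsupport h ⊆ Set.Icc (-a) a →
            Tendsto (fun n => weilFunctional (weilConv (g n) (weilReflect h))) atTop (𝓝 0)) :
    Summit.RiemannHypothesis.RiemannHypothesis.Theses.RuelleBand.CofiniteCriticalLine :=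
  cofiniteCriticalLine_of_boundedWeilIndex (boundedWeilIndex_of_END hbc hEND)

/-- **END ⟺ `CofiniteCriticalLine`** modulo continuity of the eigenvalue branches only (proved in the
tree, p84125, un-co-importable): the bet of line `cofinite-weil-index-staircase` is rung #5 re-typed on
the operator side. (Curried form; the registered anchor `END_iff_cofiniteCriticalLine` below restates it
uncurried.) [folklore] -/
theorem END_iff_cofiniteCriticalLine_of_branchesContinuous
    (hbc : ∀ k : ℕ, ContinuousOn (fun a : ℝ =>
      sInf {x : ℝ | ∃ g : Fin (k + 1) → ℝ → ℂ,
        (∀ i, IsWeilTest (g i) ∧ tsupport (g i) ⊆ Set.Icc (-a) a) ∧ LinearIndependent ℂ g ∧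
        x = sSup {y : ℝ | ∃ c : Fin (k + 1) → ℂ,
          ∫ t, ‖∑ i, c i * g i t‖ ^ 2 = (1 : ℝ) ∧
          y = (weilQuadratic (fun t => ∑ i, c i * g i t)).re}}) (Set.Ioi 0)) :
    (∃ a₀ : ℝ, ∀ a : ℝ, a₀ ≤ a →
      ¬ ∃ (u : ℝ → ℂ) (g : ℕ → ℝ → ℂ), MemLp u 2 volume ∧ ¬ (u =ᵐ[volume] 0) ∧
          (∀ n, IsWeilTest (g n) ∧ tsupport (g n) ⊆ Set.Icc (-a) a) ∧
          Tendsto (fun n => ∫ t, ‖g n t - u t‖ ^ 2) atTop (𝓝 0) ∧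
          Tendsto (fun q : ℕ × ℕ => (weilQuadratic (g q.1 - g q.2)).re) atTop (𝓝 0) ∧
          ∀ h : ℝ → ℂ, IsWeilTest h → tsupport h ⊆ Set.Icc (-a) a →
            Tendsto (fun n => weilFunctional (weilConv (g n) (weilReflect h))) atTop (𝓝 0)) ↔
    Summit.RiemannHypothesis.RiemannHypothesis.Theses.RuelleBand.CofiniteCriticalLine :=
  ⟨cofiniteCriticalLine_of_END hbc, stub_calibration_END_of_cofinite_unconditional⟩

/-- **Registered anchor (uncurried form): END ⟺ `CofiniteCriticalLine` modulo branch continuity.**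
[folklore] -/
theorem END_iff_cofiniteCriticalLine : (∀ k : ℕ, ContinuousOn (fun a : ℝ =>
      sInf {x : ℝ | ∃ g : Fin (k + 1) → ℝ → ℂ,
        (∀ i, IsWeilTest (g i) ∧ tsupport (g i) ⊆ Set.Icc (-a) a) ∧ LinearIndependent ℂ g ∧
        x = sSup {y : ℝ | ∃ c : Fin (k + 1) → ℂ,
          ∫ t, ‖∑ i, c i * g i t‖ ^ 2 = (1 : ℝ) ∧
          y = (weilQuadratic (fun t => ∑ i, c i * g i t)).re}}) (Set.Ioi 0)) →
    ((∃ a₀ : ℝ, ∀ a : ℝ, a₀ ≤ a →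
      ¬ ∃ (u : ℝ → ℂ) (g : ℕ → ℝ → ℂ), MemLp u 2 volume ∧ ¬ (u =ᵐ[volume] 0) ∧
          (∀ n, IsWeilTest (g n) ∧ tsupport (g n) ⊆ Set.Icc (-a) a) ∧
          Tendsto (fun n => ∫ t, ‖g n t - u t‖ ^ 2) atTop (𝓝 0) ∧
          Tendsto (fun q : ℕ × ℕ => (weilQuadratic (g q.1 - g q.2)).re) atTop (𝓝 0) ∧
          ∀ h : ℝ → ℂ, IsWeilTest h → tsupport h ⊆ Set.Icc (-a) a →
            Tendsto (fun n => weilFunctional (weilConv (g n) (weilReflect h))) atTop (𝓝 0)) ↔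
    Summit.RiemannHypothesis.RiemannHypothesis.Theses.RuelleBand.CofiniteCriticalLine) :=
  fun hbc => END_iff_cofiniteCriticalLine_of_branchesContinuous hbc

/-- **END ⟺ BoundedWeilIndex** (window form) modulo branch continuity: both are rung #5
(`boundedWeilIndex_iff_cofiniteCriticalLine`, p111167). [folklore] -/
theorem END_iff_boundedWeilIndex
    (hbc : ∀ k : ℕ, ContinuousOn (fun a : ℝ =>
      sInf {x : ℝ | ∃ g : Fin (k + 1) → ℝ → ℂ,
        (∀ i, IsWeilTest (g i) ∧ tsupport (g i) ⊆ Set.Icc (-a) a) ∧ LinearIndependent ℂ g ∧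
        x = sSup {y : ℝ | ∃ c : Fin (k + 1) → ℂ,
          ∫ t, ‖∑ i, c i * g i t‖ ^ 2 = (1 : ℝ) ∧
          y = (weilQuadratic (fun t => ∑ i, c i * g i t)).re}}) (Set.Ioi 0)) :
    (∃ a₀ : ℝ, ∀ a : ℝ, a₀ ≤ a →
      ¬ ∃ (u : ℝ → ℂ) (g : ℕ → ℝ → ℂ), MemLp u 2 volume ∧ ¬ (u =ᵐ[volume] 0) ∧
          (∀ n, IsWeilTest (g n) ∧ tsupport (g n) ⊆ Set.Icc (-a) a) ∧
          Tendsto (fun n => ∫ t, ‖g n t - u t‖ ^ 2) atTop (𝓝 0) ∧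
          Tendsto (fun q : ℕ × ℕ => (weilQuadratic (g q.1 - g q.2)).re) atTop (𝓝 0) ∧
          ∀ h : ℝ → ℂ, IsWeilTest h → tsupport h ⊆ Set.Icc (-a) a →
            Tendsto (fun n => weilFunctional (weilConv (g n) (weilReflect h))) atTop (𝓝 0)) ↔
    (∃ N : ℕ, ∀ a : ℝ, ∀ g : Fin (N + 1) → ℝ → ℂ, (∀ i, IsWeilTest (g i)) →
        (∀ i, tsupport (g i) ⊆ Set.Icc (-a) a) →
        ∃ c : Fin (N + 1) → ℂ, c ≠ 0 ∧ 0 ≤ (weilQuadratic (fun t => ∑ i, c i * g i t)).re) :=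
  (END_iff_cofiniteCriticalLine_of_branchesContinuous hbc).trans
    boundedWeilIndex_iff_cofiniteCriticalLine.symm

end Summit.RiemannHypothesis.RiemannHypothesis.Theorems.RuelleBandCofiniteCriticalLine

end
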